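import Summits.QuantumAdvantage.QuantumAdvantage.Theorems.WbwObfuscatedGluedTreesKowBbVocabulary

/-!
# Line `knowledge-of-walk-split`, STAGE 5 (black-box soundness) — the counting chain: registered statements,
# counting helpers, the two collision slacks, the arithmetic of the chain
# (crux `WbwObfuscatedGluedTrees`, stmt-QuantumAdvantage-2340, route WhiteBoxWalk; lead c4)

Support file of the stage-5 skeleton `Cruxes/WbwObfuscatedGluedTrees/Lines/knowledge_of_walk_split.lean` (target
`…KnowledgeOfWalkSplit.BlackBox.BlackBoxSoundness`): the name-keyed aliases `Registered.stub_*` of the seven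
registered stubs (hypotheses of the composition), generic counting helpers over finite product spaces, the
conditioning inequality `cond_le`, the two tag-collision slacks (`slackFun_le`, `slackTab_le`, from the hypothesis
`Registered.stub_collision`), the abbreviations of the function-naming space and the pure real arithmetic of the
chain (`chain_arith`).  Registered helper stub proved here: `toolkit_bbChain` (= `cond_le`).  No crux content is
asserted; every statement is elementary finite probability. [folklore]
-/

set_option linter.dupNamespace false

noncomputable section

namespace Summit.QuantumAdvantage.QuantumAdvantage.Cruxes.WbwObfuscatedGluedTrees.KnowledgeOfWalkSplit.BlackBox

open Literature.Computability.Complexity Literature.Computability.QuantumComplexity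
open Literature.Computability.QuantumComplexity.GluedTrees
open Literature.Computability.Cryptography Literature.Computability.Cryptography.ObfuscatedGluedTrees
open Summit.QuantumAdvantage.QuantumAdvantage.Theorems.WbwObfuscatedGluedTrees.KnowledgeOfWalk.BlackBox

/-! ### Name-keyed aliases of the seven statements (hypotheses of the composition; textually the stubs of §1) -/
namespace Registered

/-- Statement of `stub_simN`. -/
abbrev stub_simN : Prop :=
  ∀ (n N : ℕ), 1 ≤ n → ∀ (g : Name n ↪ (Fin N → Bool)) {β : Type} (M : OracleAlg β) (x : List Bool),
    ∃ Mg : OracleAlg β, ∀ (t : ℕ) (σ : CycleDatum n) (ν : Naming n),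
      FindsExitN M x t (σ, ν.1.trans g) → FindsExit Mg x t (σ, ν)
/-- Statement of `stub_coupling`. -/
abbrev stub_coupling : Prop :=
  ∀ (n N : ℕ), 2 * n ≤ N → ∀ (W : OutcomeN n N → Prop) [DecidablePred W],
    (Finset.univ.filter W).card * Fintype.card (Naming n × (Name n ↪ (Fin N → Bool))) =
      (Finset.univ.filter fun τ : CycleDatum n × Naming n × (Name n ↪ (Fin N → Bool)) =>
          W (τ.1, τ.2.1.1.trans τ.2.2)).card * Fintype.card (NamingN n N)
/-- Statement of `stub_bitToQuery`. -/
abbrev stub_bitToQuery : Prop :=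
  ∀ (N : ℕ), 1 ≤ N → ∀ (M : OracleAlg (List Bool)), ∃ M' : OracleAlg (List Bool),
    ∀ (d : ℕ) (x : List Bool) (t : ℕ) (σ : CycleDatum d) (ν : NamingN d N),
      BitSuccess M x t σ ν → FindsExitN M' x t (σ, ν)
/-- Statement of `stub_funToEmb`. -/
abbrev stub_funToEmb : Prop :=
  ∀ (d N : ℕ) (E : CycleDatum d → NamingN d N → Prop) [∀ σ, DecidablePred (E σ)],
    (Finset.univ.filter fun ω : CycleDatum d × (Vertex d → (Fin N → Bool)) =>
        ∃ h : Function.Injective ω.2, E ω.1 ⟨ω.2, h⟩).card =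
      (Finset.univ.filter fun ω : OutcomeN d N => E ω.1 ω.2).card ∧
    Fintype.card (OutcomeN d N) ≤ Fintype.card (CycleDatum d × (Vertex d → (Fin N → Bool)))
/-- Statement of `stub_fibre`. -/
abbrev stub_fibre : Prop :=
  ∀ (d μ : ℕ) (E : (Vertex d → (Fin (nameLen μ d) → Bool)) → Prop) [DecidablePred E],
    (Finset.univ.filter fun q : TagTable d μ × MaskTable d μ =>
        (∀ u v : Vertex d, tagPart (sivName q.1 q.2 u) = tagPart (sivName q.1 q.2 v) → u = v) ∧ E (sivName q.1 q.2)).card *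
      (Finset.univ.filter fun f : Vertex d → (Fin (nameLen μ d) → Bool) =>
        ∀ u v : Vertex d, tagPart (f u) = tagPart (f v) → u = v).card =
    (Finset.univ.filter fun f : Vertex d → (Fin (nameLen μ d) → Bool) =>
        (∀ u v : Vertex d, tagPart (f u) = tagPart (f v) → u = v) ∧ E f).card *
      (Finset.univ.filter fun q : TagTable d μ × MaskTable d μ =>
        ∀ u v : Vertex d, tagPart (sivName q.1 q.2 u) = tagPart (sivName q.1 q.2 v) → u = v).card
/-- Statement of `stub_collision`. -/
abbrev stub_collision : Prop :=
  ∀ {V A B C : Type} [Fintype V] [DecidableEq V] [Fintype A] [DecidableEq A] [Fintype B]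
    [Fintype C] [DecidableEq C] (ι : V → A) (φ : B → C), Function.Injective ι →
    (∀ c₁ c₂ : C, Fintype.card {b // φ b = c₁} = Fintype.card {b // φ b = c₂}) →
    (Finset.univ.filter fun f : A → B => ∃ u v : V, u ≠ v ∧ φ (f (ι u)) = φ (f (ι v))).card * Fintype.card C ≤
      (Fintype.card V).choose 2 * Fintype.card (A → B)
/-- Statement of `stub_namingTables`. -/
abbrev stub_namingTables : Prop :=
  ∀ (P : PuncturablePRFScheme) (μ : ℕ) (k₁ k₂ : List Bool) (d : ℕ),
    naming P μ k₁ k₂ d = sivNaming (tagTableOf P μ k₁ d) (maskTableOf P μ k₂ d)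

end Registered

/-! ## §2 Counting helpers (no stubs) -/

section Helpers

variable {α γ δ : Type} [Fintype α] [Fintype γ] [Fintype δ]

/-- Slicing a count over a binary product. -/
theorem card_filter_prod (P : α → γ → Prop) [∀ a, DecidablePred (P a)] :
    (Finset.univ.filter fun p : α × γ => P p.1 p.2).card = ∑ a, (Finset.univ.filter (P a)).card := by
  simp only [Finset.card_filter]
  rw [Fintype.sum_prod_type]

/-- Slicing a count over a ternary product along its LAST factor. -/
theorem card_filter_prod₃ (Q : α → γ → δ → Prop) [∀ a c, DecidablePred (Q a c)] :
    (Finset.univ.filter fun τ : α × γ × δ => Q τ.1 τ.2.1 τ.2.2).card =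
      ∑ z, (Finset.univ.filter fun p : α × γ => Q p.1 p.2 z).card := by
  simp only [Finset.card_filter, Fintype.sum_prod_type]
  rw [Finset.sum_congr rfl fun a _ => Finset.sum_comm, Finset.sum_comm]

/-- A count depending only on the first factor. -/
theorem card_filter_prod_left (P : α → Prop) [DecidablePred P] :
    (Finset.univ.filter fun p : α × γ => P p.1).card = (Finset.univ.filter P).card * Fintype.card γ := by
  rw [card_filter_prod (fun a (_ : γ) => P a)]
  simp_rw [Finset.filter_const]
  rw [← Finset.sum_filter_add_sum_filter_not Finset.univ P]
  rw [Finset.sum_congr rfl fun a (ha : a ∈ Finset.univ.filter P) => by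
      rw [if_pos (Finset.mem_filter.mp ha).2, Finset.card_univ],
    Finset.sum_congr rfl fun a (ha : a ∈ Finset.univ.filter fun a => ¬ P a) => by
      rw [if_neg (Finset.mem_filter.mp ha).2, Finset.card_empty]]
  simp

/-- A count depending only on the second factor. -/
theorem card_filter_prod_right (P : γ → Prop) [DecidablePred P] :
    (Finset.univ.filter fun p : α × γ => P p.2).card = Fintype.card α * (Finset.univ.filter P).card := by
  rw [card_filter_prod (fun (_ : α) c => P c)]
  simp

/-- Monotonicity of counts. -/
theorem card_filter_mono {p q : α → Prop} [DecidablePred p] [DecidablePred q] (h : ∀ a, p a → q a) :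
    (Finset.univ.filter p).card ≤ (Finset.univ.filter q).card :=
  Finset.card_le_card fun a ha => by
    simp only [Finset.mem_filter, Finset.mem_univ, true_and] at ha ⊢
    exact h a ha

/-- Conditioning on a likely event: `A/(C g) ≤ A/(C Φ) + (Φ - g)/Φ` whenever `A ≤ C g` and `g ≤ Φ`. -/
theorem cond_le {A C g Φ : ℕ} (hA : A ≤ C * g) (hg : g ≤ Φ) :
    (A : ℝ) / (C * g) ≤ A / (C * Φ) + ((Φ : ℝ) - g) / Φ := by
  rcases Nat.eq_zero_or_pos g with rfl | hg0
  · simp only [mul_zero, Nat.le_zero] at hA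
    subst hA
    simp only [CharP.cast_eq_zero, zero_div, sub_zero, zero_add]
    positivity
  rcases Nat.eq_zero_or_pos C with rfl | hC0
  · simp only [zero_mul, Nat.le_zero] at hA
    subst hA
    simp only [CharP.cast_eq_zero, zero_div, zero_add]
    exact div_nonneg (by rw [sub_nonneg]; exact_mod_cast hg) (Nat.cast_nonneg _)
  have hΦ0 : 0 < Φ := hg0.trans_le hg
  have hA' : (A : ℝ) ≤ C * g := by exact_mod_cast hA
  have hg' : (g : ℝ) ≤ Φ := by exact_mod_cast hg
  have hC' : (0 : ℝ) < C := by exact_mod_cast hC0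
  have hgr : (0 : ℝ) < g := by exact_mod_cast hg0
  have hΦr : (0 : ℝ) < Φ := by exact_mod_cast hΦ0
  have key : (A : ℝ) * (C * Φ * (Φ - g)) ≤ (C * g) * (C * Φ * (Φ - g)) :=
    mul_le_mul_of_nonneg_right hA' (mul_nonneg (mul_nonneg hC'.le hΦr.le) (sub_nonneg.mpr hg'))
  rw [div_add_div _ _ (by positivity) hΦr.ne', div_le_div_iff₀ (by positivity) (by positivity)]
  nlinarith [key]

/-- From a cross-multiplied count to a ratio bound. -/
theorem div_le_div_of_mul_le {X F Cc K : ℕ} (h : X * Cc ≤ K * F) (hC : 0 < Cc) (hF : 0 < F) :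
    (X : ℝ) / F ≤ (K : ℝ) / Cc := by
  rw [div_le_div_iff₀ (by exact_mod_cast hF) (by exact_mod_cast hC)]
  exact_mod_cast h

end Helpers

/-- The fibres of the tag projection all have `2^{2d+3}` elements (a name is its tag followed by its body). -/
theorem card_tagPart_fibre (d μ : ℕ) (c : Fin μ → Bool) :
    Fintype.card {b : Fin (nameLen μ d) → Bool // tagPart b = c} = Fintype.card (Fin (labelLen d) → Bool) := by
  refine Fintype.card_congr
    ⟨fun b => bodyPart b.1, fun m => ⟨Fin.append c m, ?_⟩, ?_, ?_⟩
  · funext i; simp [tagPart]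
  · rintro ⟨b, rfl⟩
    apply Subtype.ext
    funext i
    refine Fin.addCases (fun j => ?_) (fun j => ?_) i
    · simp [tagPart]
    · simp [bodyPart]
  · intro m; funext i; simp [bodyPart]

/-! ## §4 The two collision slacks from `stub_collision` -/

/-- **Tag collisions of a uniform function naming** are at most `tagSlack d μ`. -/
theorem slackFun_le (h₆ : Registered.stub_collision) (d μ : ℕ) :
    ((Finset.univ.filter fun f : Vertex d → (Fin (nameLen μ d) → Bool) =>
        ¬ ∀ u v : Vertex d, tagPart (f u) = tagPart (f v) → u = v).card : ℝ) /
      Fintype.card (Vertex d → (Fin (nameLen μ d) → Bool)) ≤ tagSlack d μ := by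
  classical
  have h := h₆ (V := Vertex d) (A := Vertex d) (B := Fin (nameLen μ d) → Bool) (C := Fin μ → Bool) id
    (tagPart (d := d) (μ := μ)) Function.injective_id
    (fun c₁ c₂ => by rw [card_tagPart_fibre, card_tagPart_fibre])
  have heq : (Finset.univ.filter fun f : Vertex d → (Fin (nameLen μ d) → Bool) =>
        ¬ ∀ u v : Vertex d, tagPart (f u) = tagPart (f v) → u = v) =
      (Finset.univ.filter fun f : Vertex d → (Fin (nameLen μ d) → Bool) =>
        ∃ u v : Vertex d, u ≠ v ∧ tagPart (f (id u)) = tagPart (f (id v))) := by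
    refine Finset.filter_congr fun f _ => ?_
    simp only [id_eq, not_forall, exists_prop]
    exact ⟨fun ⟨u, v, h1, h2⟩ => ⟨u, v, h2, h1⟩, fun ⟨u, v, h1, h2⟩ => ⟨u, v, h2, h1⟩⟩
  rw [heq]
  unfold tagSlack
  rw [show (2 : ℝ) ^ μ = ((Fintype.card (Fin μ → Bool) : ℕ) : ℝ) by
    rw [Fintype.card_fun, Fintype.card_bool, Fintype.card_fin]; push_cast; ring]
  exact div_le_div_of_mul_le h Fintype.card_pos Fintype.card_pos

/-- **Tag collisions of the ideal SIV naming** (a collision of the tag TABLE on two labels) are at most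
`tagSlack d μ`. -/
theorem slackTab_le (h₆ : Registered.stub_collision) (d μ : ℕ) :
    ((Finset.univ.filter fun q : TagTable d μ × MaskTable d μ =>
        ¬ ∀ u v : Vertex d, tagPart (sivName q.1 q.2 u) = tagPart (sivName q.1 q.2 v) → u = v).card : ℝ) /
      Fintype.card (TagTable d μ × MaskTable d μ) ≤ tagSlack d μ := by
  classical
  have h := h₆ (V := Vertex d) (A := Fin (labelLen d) → Bool) (B := Fin μ → Bool) (C := Fin μ → Bool) (labelVec d)
    id (labelVec_injective d) (fun c₁ c₂ => by simp)
  -- the event depends on the tag table only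
  have heq : (Finset.univ.filter fun q : TagTable d μ × MaskTable d μ =>
        ¬ ∀ u v : Vertex d, tagPart (sivName q.1 q.2 u) = tagPart (sivName q.1 q.2 v) → u = v) =
      (Finset.univ.filter fun q : TagTable d μ × MaskTable d μ =>
        ∃ u v : Vertex d, u ≠ v ∧ id (q.1 (labelVec d u)) = id (q.1 (labelVec d v))) := by
    refine Finset.filter_congr fun q _ => ?_
    simp only [tagPart_sivName, id_eq, not_forall, exists_prop]
    exact ⟨fun ⟨u, v, h1, h2⟩ => ⟨u, v, h2, h1⟩, fun ⟨u, v, h1, h2⟩ => ⟨u, v, h2, h1⟩⟩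
  rw [heq, card_filter_prod_left (fun T : TagTable d μ => ∃ u v : Vertex d, u ≠ v ∧
    id (T (labelVec d u)) = id (T (labelVec d v))), Fintype.card_prod]
  push_cast
  have hM : (0 : ℝ) < Fintype.card (MaskTable d μ) := by exact_mod_cast Fintype.card_pos
  rw [mul_div_mul_right _ _ hM.ne']
  unfold tagSlack
  rw [show (2 : ℝ) ^ μ = ((Fintype.card (Fin μ → Bool) : ℕ) : ℝ) by
    rw [Fintype.card_fun, Fintype.card_bool, Fintype.card_fin]; push_cast; ring]
  exact div_le_div_of_mul_le h Fintype.card_pos Fintype.card_pos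

/-! ## §5 Conjunct (i): the ideal-model bound -/

/-- The function namings at tag length `μ`. -/
abbrev FunN (d μ : ℕ) : Type := Vertex d → (Fin (nameLen μ d) → Bool)

/-- The pairs (tag table, mask table). -/
abbrev Tab (d μ : ℕ) : Type := TagTable d μ × MaskTable d μ

/-- Tag-distinctness of a function naming. -/
abbrev TDF {d μ : ℕ} (f : FunN d μ) : Prop := ∀ u v : Vertex d, tagPart (f u) = tagPart (f v) → u = v

/-- The ideal SIV naming of a pair of tables, as a function. -/
abbrev sivF {d μ : ℕ} (q : Tab d μ) : FunN d μ := sivName q.1 q.2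

/-- The success event transported to function namings (false on the non-injective ones). -/
abbrev EvF {d μ : ℕ} (M : OracleAlg (List Bool)) (x : List Bool) (t : ℕ) (σ : CycleDatum d) (f : FunN d μ) : Prop :=
  ∃ h : Function.Injective f, BitSuccess M x t σ ⟨f, h⟩

/-- **The arithmetic of the chain** (pure real arithmetic on the thirteen counts). -/
theorem chain_arith {SA Sa Ss numE numO numF cC cTab cFun g Gt Bt cO : ℕ} {b tS : ℝ}
    (h1 : numE ≤ SA + cC * Bt) (hfib : SA * g = Sa * Gt) (hGt : Gt ≤ cTab) (hg0 : g = 0 → SA = 0)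
    (ha : Sa ≤ cC * g) (ha' : Sa ≤ Ss) (hs : Ss ≤ numO) (hOF : numO ≤ numF) (hFO : numF ≤ cO)
    (hcO : cO ≤ cC * cFun) (h9 : (numF : ℝ) / cO ≤ b) (hgF : g ≤ cFun)
    (slackF : ((cFun - g : ℕ) : ℝ) / cFun ≤ tS) (slackT : (Bt : ℝ) / cTab ≤ tS)
    (hcC : 0 < cC) (hcTab : 0 < cTab) (hcFun : 0 < cFun) (hb : 0 ≤ b) :
    (numE : ℝ) / (cC * cTab) ≤ b + 2 * tS := by
  have hcCr : (0 : ℝ) < cC := by exact_mod_cast hcC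
  have hcTabr : (0 : ℝ) < cTab := by exact_mod_cast hcTab
  have hcFunr : (0 : ℝ) < cFun := by exact_mod_cast hcFun
  -- (i) split off the table-collision slack
  have hi : (numE : ℝ) / (cC * cTab) ≤ SA / (cC * cTab) + tS := by
    calc (numE : ℝ) / (cC * cTab) ≤ ((SA + cC * Bt : ℕ) : ℝ) / (cC * cTab) := by
          gcongr
      _ = SA / (cC * cTab) + (Bt : ℝ) / cTab := by
          push_cast
          rw [add_div, mul_div_mul_left _ _ hcCr.ne']
      _ ≤ SA / (cC * cTab) + tS := by linarith [slackT]
  -- (ii) equal fibres: pass to the tag-distinct function namings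
  have hii : (SA : ℝ) / (cC * cTab) ≤ Sa / (cC * g) := by
    rcases Nat.eq_zero_or_pos g with hgz | hgp
    · rw [hg0 hgz, hgz]; simp
    · have hgr : (0 : ℝ) < g := by exact_mod_cast hgp
      rw [div_le_div_iff₀ (by positivity) (by positivity)]
      have e1 : (SA : ℝ) * g = Sa * Gt := by exact_mod_cast hfib
      have e2 : (Gt : ℝ) ≤ cTab := by exact_mod_cast hGt
      have e3 : (0 : ℝ) ≤ Sa := Nat.cast_nonneg _
      calc (SA : ℝ) * (cC * g) = cC * (SA * g) := by ring
        _ = cC * (Sa * Gt) := by rw [e1]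
        _ ≤ cC * (Sa * cTab) := by gcongr
        _ = Sa * (cC * cTab) := by ring
  -- (iii) conditioning on tag-distinctness
  have hiii : (Sa : ℝ) / (cC * g) ≤ Sa / (cC * cFun) + tS := by
    refine (cond_le ha hgF).trans (add_le_add le_rfl (le_trans (le_of_eq ?_) slackF))
    rw [Nat.cast_sub hgF]
  -- (iv) functions → embeddings → queries → Theorem 9
  have hiv : (Sa : ℝ) / (cC * cFun) ≤ b := by
    have e1 : (Sa : ℝ) ≤ numF := by exact_mod_cast ha'.trans (hs.trans hOF)
    rcases Nat.eq_zero_or_pos cO with hz | hp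
    · have : numF = 0 := Nat.eq_zero_of_le_zero (hFO.trans_eq hz)
      rw [this] at e1
      have : (Sa : ℝ) = 0 := le_antisymm (by simpa using e1) (Nat.cast_nonneg _)
      rw [this, zero_div]; exact hb
    · have hcOr : (0 : ℝ) < cO := by exact_mod_cast hp
      calc (Sa : ℝ) / (cC * cFun) ≤ numF / (cC * cFun) := by gcongr
        _ ≤ numF / cO := div_le_div_of_nonneg_left (Nat.cast_nonneg _) hcOr (by exact_mod_cast hcO)
        _ ≤ b := h9
  linarith

/-- Registered helper stub of crux stmt-QuantumAdvantage-2340 (`toolkit_bbChain`, so that this support file lands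
`--supports`): the conditioning inequality `cond_le`. [folklore] -/
theorem toolkit_bbChain : ∀ {A C g Φ : ℕ}, A ≤ C * g → g ≤ Φ →
    (A : ℝ) / (C * g) ≤ A / (C * Φ) + ((Φ : ℝ) - g) / Φ :=
  fun hA hg => cond_le hA hg

end Summit.QuantumAdvantage.QuantumAdvantage.Cruxes.WbwObfuscatedGluedTrees.KnowledgeOfWalkSplit.BlackBox

end
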